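import Literature.Probability.LatticeModels.LatticeGreenPoisson
import Mathlib.Analysis.InnerProductSpace.PiL2
import HarnessLib

/-!
# Route `PerfectScreening`, item `ScreeningDichotomy` (stmt-CriticalPhenomena-1348), helper file 1:
# elementary estimates on the lattice Green function of `ℤ³` from its `a/|x|` asymptotics

THEOREM-ONLY file (no definitions, no named facts). Throughout, `g = latticeGreen : ℤ³ → ℝ` is the
tree's lattice Green function (`LatticeGreenFunction.lean`; `g/2` is the Green function of the graph
Laplacian, `LatticeGreenPoisson.lean`) and the standing hypothesis is the asymptotics
`|g x - a/|x|₂| ≤ K/|x|₂²` for `x ≠ 0` with `a > 0` (the antecedent `GreenAsymptotics` of the item,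
doubled), `|x|₂ = (∑ᵢ xᵢ²)^{1/2}`; `‖x‖` is the sup norm of `x : Site 3 = (Fin 3 → ℤ)`.

* norms: `‖x‖ ≤ |x|₂ ≤ 2‖x‖`, `1 ≤ ‖x‖` for `x ≠ 0`;
* pointwise: `g x ≤ (a+K)/‖x‖`, `a/(2‖x‖) - K/‖x‖² ≤ g x`, `g` bounded and nonnegative, and the
  translate estimate `|g x - g (x - y)| ≤ (4a‖y‖ + 5K)/‖x‖²` for `‖x‖ ≥ 2‖y‖ + 1`.

The companion file `PerfectScreeningScreeningDichotomyGreenSums.lean` turns these into box-sum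
estimates; both feed the Riesz decomposition / screening dichotomy of the item.
References: G. F. Lawler, V. Limic, *Random Walk: A Modern Introduction* (2010), §4.3, §6.1–6.2.
-/

noncomputable section

namespace Summit.CriticalPhenomena.Ising3DConformalLimit.Theorems.PerfectScreening

open Literature.Probability.LatticeModels Finset Filter
open scoped Topology BigOperators

/-! ### Norms on `ℤ³` -/

/-- Each coordinate is bounded by the sup norm: `|xᵢ| ≤ ‖x‖`. [folklore] -/
theorem abs_intCast_apply_le_norm (x : Site 3) (i : Fin 3) : |(x i : ℝ)| ≤ ‖x‖ := by
  have h := norm_le_pi_norm x i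
  rwa [Int.norm_eq_abs] at h

/-- `1 ≤ ‖x‖` for `x ≠ 0` in `ℤ³`. [folklore] -/
theorem one_le_norm_of_ne_zero {x : Site 3} (hx : x ≠ 0) : 1 ≤ ‖x‖ := by
  rw [Site.norm_eq_supNorm]
  have h : Site.supNorm x ≠ 0 := fun h => hx (Site.supNorm_eq_zero_iff.1 h)
  exact_mod_cast Nat.one_le_iff_ne_zero.2 h

/-- `0 < ‖x‖` for `x ≠ 0` in `ℤ³`. [folklore] -/
theorem norm_pos_of_ne_zero {x : Site 3} (hx : x ≠ 0) : 0 < ‖x‖ :=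
  lt_of_lt_of_le one_pos (one_le_norm_of_ne_zero hx)

/-- The sup norm is at most the Euclidean norm: `‖x‖ ≤ (∑ᵢ xᵢ²)^{1/2}`. [folklore] -/
theorem norm_le_sqrt_sum_sq (x : Site 3) : ‖x‖ ≤ Real.sqrt (∑ i, (x i : ℝ) ^ 2) := by
  refine (pi_norm_le_iff_of_nonneg (Real.sqrt_nonneg _)).2 fun i => ?_
  rw [Int.norm_eq_abs]
  refine Real.abs_le_sqrt ?_
  exact Finset.single_le_sum (f := fun j => ((x j : ℝ)) ^ 2) (fun j _ => sq_nonneg _)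
    (Finset.mem_univ i)

/-- `∑ᵢ xᵢ² ≤ 3 ‖x‖²`. [folklore] -/
theorem sum_sq_le_three_mul_norm_sq (x : Site 3) : ∑ i, (x i : ℝ) ^ 2 ≤ 3 * ‖x‖ ^ 2 := by
  have h : ∀ i, (x i : ℝ) ^ 2 ≤ ‖x‖ ^ 2 := fun i => by
    have := abs_intCast_apply_le_norm x i
    rw [← sq_abs]
    exact pow_le_pow_left₀ (abs_nonneg _) this 2
  calc ∑ i, (x i : ℝ) ^ 2 ≤ ∑ _i : Fin 3, ‖x‖ ^ 2 := Finset.sum_le_sum fun i _ => h i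
    _ = 3 * ‖x‖ ^ 2 := by simp

/-- The Euclidean norm is at most twice the sup norm: `(∑ᵢ xᵢ²)^{1/2} ≤ 2‖x‖`. [folklore] -/
theorem sqrt_sum_sq_le_two_mul_norm (x : Site 3) : Real.sqrt (∑ i, (x i : ℝ) ^ 2) ≤ 2 * ‖x‖ := by
  rw [Real.sqrt_le_left (by positivity)]
  nlinarith [sum_sq_le_three_mul_norm_sq x, norm_nonneg x]

/-- `1 ≤ ∑ᵢ xᵢ²` for `x ≠ 0`. [folklore] -/
theorem one_le_sum_sq {x : Site 3} (hx : x ≠ 0) : 1 ≤ ∑ i, (x i : ℝ) ^ 2 := by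
  have h1 := one_le_norm_of_ne_zero hx
  have h2 := norm_le_sqrt_sum_sq x
  have h3 : 1 ≤ Real.sqrt (∑ i, (x i : ℝ) ^ 2) := h1.trans h2
  have h4 : 0 ≤ ∑ i, (x i : ℝ) ^ 2 := Finset.sum_nonneg fun i _ => sq_nonneg _
  nlinarith [Real.sq_sqrt h4]

/-- The Euclidean norm of `x : ℤ³` as the norm of a point of `EuclideanSpace ℝ (Fin 3)`. [folklore] -/
theorem sqrt_sum_sq_eq_norm_toLp (x : Site 3) :
    Real.sqrt (∑ i, (x i : ℝ) ^ 2) = ‖(WithLp.toLp 2 (fun i => (x i : ℝ)) : EuclideanSpace ℝ (Fin 3))‖ := by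
  rw [EuclideanSpace.norm_eq]
  congr 1
  refine Finset.sum_congr rfl fun i _ => ?_
  simp [Real.norm_eq_abs, sq_abs]

/-- Reverse triangle inequality for the Euclidean norm on `ℤ³`:
`|‖x‖₂ - ‖x - y‖₂| ≤ ‖y‖₂ ≤ 2‖y‖`. [folklore] -/
theorem abs_sqrt_sum_sq_sub_le (x y : Site 3) :
    |Real.sqrt (∑ i, (x i : ℝ) ^ 2) - Real.sqrt (∑ i, ((x - y) i : ℝ) ^ 2)| ≤ 2 * ‖y‖ := by
  rw [sqrt_sum_sq_eq_norm_toLp, sqrt_sum_sq_eq_norm_toLp]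
  refine (abs_norm_sub_norm_le _ _).trans ?_
  have h : (WithLp.toLp 2 (fun i => (x i : ℝ)) : EuclideanSpace ℝ (Fin 3)) -
      WithLp.toLp 2 (fun i => ((x - y) i : ℝ)) = WithLp.toLp 2 (fun i => (y i : ℝ)) := by
    rw [← WithLp.toLp_sub]
    congr 1
    funext i
    simp
  rw [h, ← sqrt_sum_sq_eq_norm_toLp]
  exact sqrt_sum_sq_le_two_mul_norm y

/-! ### Pointwise bounds on the Green function from the asymptotics -/

/-- The constant `K` of the asymptotics is nonnegative. [folklore] -/
theorem asymp_K_nonneg {a K : ℝ}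
    (hg : ∀ x : Site 3, x ≠ 0 →
      |latticeGreen x - a / Real.sqrt (∑ i, (x i : ℝ) ^ 2)| ≤ K / ∑ i, (x i : ℝ) ^ 2) : 0 ≤ K := by
  have hx : (Pi.single 0 1 : Site 3) ≠ 0 := by
    intro h
    have := congrArg (fun z : Site 3 => z 0) h
    simp at this
  have h := hg _ hx
  have hS : 0 < ∑ i, ((Pi.single 0 1 : Site 3) i : ℝ) ^ 2 := lt_of_lt_of_le one_pos (one_le_sum_sq hx)
  have h2 : 0 ≤ K / ∑ i, ((Pi.single 0 1 : Site 3) i : ℝ) ^ 2 := (abs_nonneg _).trans h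
  rwa [le_div_iff₀ hS, zero_mul] at h2

/-- Upper bound `g x ≤ (a + K)/‖x‖` for `x ≠ 0` (`‖x‖ ≤ |x|₂`, `1 ≤ ‖x‖`). [folklore] -/
theorem green_le_div_norm {a K : ℝ} (ha : 0 ≤ a)
    (hg : ∀ x : Site 3, x ≠ 0 →
      |latticeGreen x - a / Real.sqrt (∑ i, (x i : ℝ) ^ 2)| ≤ K / ∑ i, (x i : ℝ) ^ 2)
    {x : Site 3} (hx : x ≠ 0) : latticeGreen x ≤ (a + K) / ‖x‖ := by
  have hK := asymp_K_nonneg hg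
  have h := hg x hx
  have h1 := one_le_norm_of_ne_zero hx
  have hr := norm_le_sqrt_sum_sq x
  set r := Real.sqrt (∑ i, (x i : ℝ) ^ 2) with hr_def
  have hS0 : 0 ≤ ∑ i, (x i : ℝ) ^ 2 := Finset.sum_nonneg fun i _ => sq_nonneg _
  have hrS : r ^ 2 = ∑ i, (x i : ℝ) ^ 2 := Real.sq_sqrt hS0
  rw [← hrS] at h
  have hr1 : 1 ≤ r := h1.trans hr
  have hr0 : 0 < r := by linarith
  have hup : latticeGreen x ≤ a / r + K / r ^ 2 := by
    have := (abs_le.1 h).2; linarith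
  have h2 : a / r ≤ a / ‖x‖ := div_le_div_of_nonneg_left ha (by linarith) hr
  have h3 : K / r ^ 2 ≤ K / ‖x‖ := by
    refine div_le_div_of_nonneg_left hK (by linarith) ?_
    nlinarith
  rw [add_div]
  linarith

/-- Lower bound `a/(2‖x‖) - K/‖x‖² ≤ g x` for `x ≠ 0` (`|x|₂ ≤ 2‖x‖`, `‖x‖ ≤ |x|₂`). [folklore] -/
theorem green_ge_sub {a K : ℝ} (ha : 0 ≤ a)
    (hg : ∀ x : Site 3, x ≠ 0 →
      |latticeGreen x - a / Real.sqrt (∑ i, (x i : ℝ) ^ 2)| ≤ K / ∑ i, (x i : ℝ) ^ 2)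
    {x : Site 3} (hx : x ≠ 0) : a / (2 * ‖x‖) - K / ‖x‖ ^ 2 ≤ latticeGreen x := by
  have hK := asymp_K_nonneg hg
  have h := hg x hx
  have h1 := one_le_norm_of_ne_zero hx
  have hr := norm_le_sqrt_sum_sq x
  have hr2 := sqrt_sum_sq_le_two_mul_norm x
  set r := Real.sqrt (∑ i, (x i : ℝ) ^ 2) with hr_def
  have hS0 : 0 ≤ ∑ i, (x i : ℝ) ^ 2 := Finset.sum_nonneg fun i _ => sq_nonneg _
  have hrS : r ^ 2 = ∑ i, (x i : ℝ) ^ 2 := Real.sq_sqrt hS0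
  rw [← hrS] at h
  have hr1 : 1 ≤ r := h1.trans hr
  have hr0 : 0 < r := by linarith
  have hlo : a / r - K / r ^ 2 ≤ latticeGreen x := by
    have := (abs_le.1 h).1; linarith
  have h2 : a / (2 * ‖x‖) ≤ a / r := div_le_div_of_nonneg_left ha hr0 hr2
  have h3 : K / r ^ 2 ≤ K / ‖x‖ ^ 2 := by
    refine div_le_div_of_nonneg_left hK (by positivity) ?_
    nlinarith
  linarith

/-- `‖x‖ · g x ≤ a + K` for `x ≠ 0`. [folklore] -/
theorem norm_mul_green_le {a K : ℝ} (ha : 0 ≤ a)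
    (hg : ∀ x : Site 3, x ≠ 0 →
      |latticeGreen x - a / Real.sqrt (∑ i, (x i : ℝ) ^ 2)| ≤ K / ∑ i, (x i : ℝ) ^ 2)
    {x : Site 3} (hx : x ≠ 0) : ‖x‖ * latticeGreen x ≤ a + K := by
  have h := green_le_div_norm ha hg hx
  have h0 := norm_pos_of_ne_zero hx
  rwa [le_div_iff₀ h0, mul_comm] at h

/-- The Green function is bounded: `g x ≤ max (g 0) (a + K)` for all `x`. [folklore] -/
theorem green_le_bound {a K : ℝ} (ha : 0 ≤ a)
    (hg : ∀ x : Site 3, x ≠ 0 →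
      |latticeGreen x - a / Real.sqrt (∑ i, (x i : ℝ) ^ 2)| ≤ K / ∑ i, (x i : ℝ) ^ 2)
    (x : Site 3) : latticeGreen x ≤ max (latticeGreen (0 : Site 3)) (a + K) := by
  by_cases hx : x = 0
  · rw [hx]; exact le_max_left _ _
  · refine le_trans ?_ (le_max_right _ _)
    have hK := asymp_K_nonneg hg
    have h := green_le_div_norm ha hg hx
    have h1 := one_le_norm_of_ne_zero hx
    calc latticeGreen x ≤ (a + K) / ‖x‖ := h
      _ ≤ a + K := div_le_self (by positivity) h1

/-- The lattice Green function of `ℤ³` is nonnegative (superharmonic and tending to `0` at infinity;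
minimum principle). [folklore] -/
theorem green_nonneg (x : Site 3) : 0 ≤ latticeGreen x :=
  (isZdSuperharmonicOn_latticeGreen 3 le_rfl).nonneg_of_tendsto_zero (by norm_num)
    (tendsto_latticeGreen_cofinite 3 le_rfl) x

/-- **Translate estimate**: for `‖x‖ ≥ 2‖y‖ + 1`,
`|g x - g (x - y)| ≤ (4a‖y‖ + 5K)/‖x‖²`. [folklore] -/
theorem abs_green_sub_green_sub_le {a K : ℝ} (ha : 0 ≤ a)
    (hg : ∀ x : Site 3, x ≠ 0 →
      |latticeGreen x - a / Real.sqrt (∑ i, (x i : ℝ) ^ 2)| ≤ K / ∑ i, (x i : ℝ) ^ 2)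
    {x y : Site 3} (hxy : 2 * ‖y‖ + 1 ≤ ‖x‖) :
    |latticeGreen x - latticeGreen (x - y)| ≤ (4 * a * ‖y‖ + 5 * K) / ‖x‖ ^ 2 := by
  have hK := asymp_K_nonneg hg
  have hy0 : 0 ≤ ‖y‖ := norm_nonneg y
  have hx1 : 1 ≤ ‖x‖ := by linarith
  have hx0 : 0 < ‖x‖ := by linarith
  have hx : x ≠ 0 := fun h => by rw [h, norm_zero] at hx1; linarith
  -- `‖x - y‖ ≥ ‖x‖ - ‖y‖ ≥ (‖x‖ + 1)/2`
  have hxy' : ‖x‖ - ‖y‖ ≤ ‖x - y‖ := norm_sub_norm_le x y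
  have hxy1 : (‖x‖ + 1) / 2 ≤ ‖x - y‖ := by linarith
  have hxy0 : x - y ≠ 0 := fun h => by rw [h, norm_zero] at hxy1; linarith
  -- the two asymptotics
  have h1 := hg x hx
  have h2 := hg (x - y) hxy0
  have hr : ‖x‖ ≤ Real.sqrt (∑ i, (x i : ℝ) ^ 2) := norm_le_sqrt_sum_sq x
  have hs : ‖x - y‖ ≤ Real.sqrt (∑ i, ((x - y) i : ℝ) ^ 2) := norm_le_sqrt_sum_sq (x - y)
  have hrs : |Real.sqrt (∑ i, (x i : ℝ) ^ 2) - Real.sqrt (∑ i, ((x - y) i : ℝ) ^ 2)| ≤ 2 * ‖y‖ :=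
    abs_sqrt_sum_sq_sub_le x y
  have hSx0 : 0 ≤ ∑ i, (x i : ℝ) ^ 2 := Finset.sum_nonneg fun i _ => sq_nonneg _
  have hSs0 : 0 ≤ ∑ i, ((x - y) i : ℝ) ^ 2 := Finset.sum_nonneg fun i _ => sq_nonneg _
  have hrS : Real.sqrt (∑ i, (x i : ℝ) ^ 2) ^ 2 = ∑ i, (x i : ℝ) ^ 2 := Real.sq_sqrt hSx0
  have hsS : Real.sqrt (∑ i, ((x - y) i : ℝ) ^ 2) ^ 2 = ∑ i, ((x - y) i : ℝ) ^ 2 := Real.sq_sqrt hSs0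
  set r := Real.sqrt (∑ i, (x i : ℝ) ^ 2) with hr_def
  set s := Real.sqrt (∑ i, ((x - y) i : ℝ) ^ 2) with hs_def
  rw [← hrS] at h1
  rw [← hsS] at h2
  have hr0 : 0 < r := by linarith
  have hs1 : ‖x‖ / 2 ≤ s := by linarith
  have hs0 : 0 < s := by linarith
  -- `|a/r - a/s| ≤ a · 2‖y‖/(r s) ≤ 4a‖y‖/‖x‖²`
  have hA : |a / r - a / s| ≤ 4 * a * ‖y‖ / ‖x‖ ^ 2 := by
    have hrs0 : 0 < r * s := mul_pos hr0 hs0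
    have heq : a / r - a / s = a * (s - r) / (r * s) := by
      rw [div_sub_div _ _ hr0.ne' hs0.ne']
      ring
    have h3 : |s - r| ≤ 2 * ‖y‖ := by rw [abs_sub_comm]; exact hrs
    have h4 : ‖x‖ ^ 2 ≤ 2 * (r * s) := by nlinarith
    have h5 : |a * (s - r)| ≤ a * (2 * ‖y‖) := by
      rw [abs_mul, abs_of_nonneg ha]
      exact mul_le_mul_of_nonneg_left h3 ha
    rw [heq, abs_div, abs_of_pos hrs0, div_le_div_iff₀ hrs0 (by positivity)]
    calc |a * (s - r)| * ‖x‖ ^ 2 ≤ a * (2 * ‖y‖) * (2 * (r * s)) := by gcongr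
      _ = 4 * a * ‖y‖ * (r * s) := by ring
  have hB : K / r ^ 2 ≤ K / ‖x‖ ^ 2 :=
    div_le_div_of_nonneg_left hK (by positivity) (by nlinarith)
  have hC : K / s ^ 2 ≤ 4 * K / ‖x‖ ^ 2 := by
    rw [div_le_div_iff₀ (by positivity) (by positivity)]
    have h6 : ‖x‖ ^ 2 ≤ 4 * s ^ 2 := by nlinarith
    nlinarith [mul_le_mul_of_nonneg_left h6 hK]
  have key : |latticeGreen x - latticeGreen (x - y)| ≤
      |a / r - a / s| + K / r ^ 2 + K / s ^ 2 := by
    have e : latticeGreen x - latticeGreen (x - y) =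
        (latticeGreen x - a / r) - (latticeGreen (x - y) - a / s) + (a / r - a / s) := by ring
    rw [e]
    have hX : |latticeGreen x - a / r - (latticeGreen (x - y) - a / s)| ≤ K / r ^ 2 + K / s ^ 2 :=
      (abs_sub _ _).trans (add_le_add h1 h2)
    linarith [abs_add_le (latticeGreen x - a / r - (latticeGreen (x - y) - a / s)) (a / r - a / s)]
  calc |latticeGreen x - latticeGreen (x - y)| ≤ |a / r - a / s| + K / r ^ 2 + K / s ^ 2 := key
    _ ≤ 4 * a * ‖y‖ / ‖x‖ ^ 2 + K / ‖x‖ ^ 2 + 4 * K / ‖x‖ ^ 2 := by linarith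
    _ = (4 * a * ‖y‖ + 5 * K) / ‖x‖ ^ 2 := by ring

end Summit.CriticalPhenomena.Ising3DConformalLimit.Theorems.PerfectScreening
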